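/-
Copyright: the b2b-balaban T⁴-continuum CRUX team, row NE7b, leaf prover `t4-ne7b-formalise-leaf-01` (gen 79), for the
OWNER lineage `t4-ne7b-p1` (gen 105's `GaussianShiftedFibre`, residual (R1″)) and the refuter desk (κ-ne7bref-g66-1 ∕ g67-4 (a)).
Project licence.
-/
import Summits.QuantumFields.BalabanUV.T4Continuum.Spine.NE7b.LogConcaveDominatedMoment
import Summits.QuantumFields.BalabanUV.T4Continuum.Spine.NE7b.GaussianShiftedFibre
import Summits.QuantumFields.BalabanUV.T4Continuum.Spine.NE7b.GaussianDeterminant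

/-!
# THE SHIFTED FIBRE MOMENT FOR AN EVEN LOG-CONCAVE WINDOW: ANDERSON's SHIFT FORM GIVES THE NUMERATOR THE SHARP GAUSSIAN
# EXPONENT — no Young inflation; the denominator's displacement is the displayed (R1″) letter (row NE7b, node U5c; model level)

Cell `pub-balaban`, sub-cell `t4`, spine estimate NE7b (`T4WeightBudget.RelWeightBound` — the cell's OWN estimate, NOT PRINTED in
[Bałaban 1983–89], NOT PROVED).  Crux-route MODEL work under `Spine/NE7b/` in the OWNER's currency (`GaussianShiftedFibre`); no
`T4Continuum/Support` leaf, no `Prop` minted, nothing of [B15]∕[B16] named; 0 `sorry`.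

WHY.  In the fibrewise frame (OWNER `GaussianFibrewiseDecoupling` ∕ `GaussianShiftedFibre`) the near fibre over a far small field `x₂`
is the SHIFTED kernel `F(x)·e^{−(xᵀSx + 2x·v)}`, `v = S₁₂x₂`: the sacrificed form `e^{xᵀQx}` and the fibre weight complete to DIFFERENT
centres `−m₁ = −(S−Q)⁻¹v` and `−m₀ = −S⁻¹v` while the window `F` stays centred at `0` (refuter κ-ne7bref-g66-1 ∕ g67-4 (a)).  The OWNER's
`shiftedMoment_le` pays for this with Young's inequality: exponent `(1+ε⁻¹)·m₀ᵀQm₀` AND an inflated domination `δ'` for `(1+ε)Q`.  For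
an EVEN, MIDPOINT-LOG-CONCAVE window `F` (the zero-cost class of `LogConcaveDominatedMoment`) Anderson's SHIFT inequality
(`AndersonGaussianComparison.lintegral_shift_mul_le`: a translate of `F` weighs less against a centred Gaussian) gives the NUMERATOR the
SHARP exponent with NO inflation:
  `∫ F·e^{xᵀQx}·e^{−(xᵀSx + 2x·v)} ≤ e^{m₁ᵀ(S−Q)m₁} · (√(1−δ))⁻¹ ^ r · ∫ F·e^{−xᵀSx}`   (`logConcaveShiftedNumerator_le`),
`m₁ᵀ(S−Q)m₁ = vᵀ(S−Q)⁻¹v` being exactly the Gaussian value (`F ≡ 1`: equality of the `v`-dependence).  The DENOMINATOR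
`∫ F·e^{−(xᵀSx + 2x·v)} = e^{m₀ᵀSm₀}·∫ F(u − m₀)e^{−uᵀSu}` can only DROP under the displacement (Anderson again) — how much is the
(R1″) letter, displayed here in relative form `hdisp : (1−η')·∫ F e^{−S} ≤ ∫ F(· − m₀) e^{−S}` (for windows it is the OWNER's
`GaussianTranslatedMass`): `logConcaveShiftedMoment_le` — ratio `≤ e^{E(v)}·(√(1−δ))⁻¹ ^ r ∕ (1−η')` with the refuter's closed-form
exponent `E(v) = m₁ᵀ(S−Q)m₁ − m₀ᵀSm₀ = vᵀ((S−Q)⁻¹ − S⁻¹)v` (κ-ne7bref-g66-1; sharp at `F ≡ 1`).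

WHAT IS PROVED ([folklore]; `(S − Q).PosDef` is the OWNER's `GaussianDeterminant.posDef_sub_of_dominated`, BY NAME): §1 `integral_shift_mul_exp_neg_qf_le` (Anderson's shift inequality in Bochner
form for the weight `e^{−uᵀAu}`, `A` positive definite: `∫ F(u − m)e^{−uᵀAu} ≤ ∫ F e^{−uᵀAu}`); §2 **`logConcaveShiftedNumerator_le`**;
§3 **`logConcaveShiftedMoment_le`** (the ratio under the displayed displacement letter); §4 `qf_inv_mulVec`, **`shiftExponent_bounds`**
(`m₀ᵀQm₀ ≤ E(v) ≤ (1−δ)⁻¹·m₀ᵀQm₀` — the refuter's κ-ne7bref-g66-1 inequality as a theorem, by the OWNER's simultaneous diagonalisation: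
`S⁻¹ = AAᵀ`, `(S−Q)⁻¹ = A·diag((1−dᵢ)⁻¹)·Aᵀ`) and `logConcaveShiftedMoment_le_of_inducedMean_le` (the ratio in the OWNER's letters:
`m₀ᵀQm₀ ≤ B₀` ⊢ `≤ e^{B₀∕(1−δ)}·(√(1−δ))⁻¹ ^ r ∕ (1−η')`).

NOT HERE (honest).  The displacement letter itself ((R1″): induced-mean energies ∕ translated masses — OWNER `GaussianTranslatedMass`,
gaps-ne6 `GaussianInducedMeanDecay`); odd ∕ non-convex remainders ((R2) proper); the identification (A3); print's windows are nonlinear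
sublevel sets — symmetric convex only in the `qfBall` idealisation.  BY-NAME EFFECT ON THE WALL: NONE.  NE7b NOT PRINTED ∕ NOT PROVED;
spine PROVED 0∕9; rung (B)+1 on a FINITE torus — NOT infinite volume, NOT the mass gap, NOT Clay.
HONEST DEPENDENCY: continuum YM on T⁴ ⇐ BetaPertH ∧ nine spine estimates (0/9 proved); BetaPertH ⇐ (D1) ∧ (D4) ∧ CAP+tail;
G-an2-4 gates asym, D1 and NE2/3/4.
-/

set_option autoImplicit false

open MeasureTheory Real Matrix Finset
open scoped ENNReal
open Summit.QuantumFields.BalabanUV.T4Continuum.NE7b.QuadFormSimDiag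
open Summit.QuantumFields.BalabanUV.T4Continuum.NE7b.GaussianDominatedMoment
open Summit.QuantumFields.BalabanUV.T4Continuum.NE7b.GaussianRestrictedMoment
open Summit.QuantumFields.BalabanUV.T4Continuum.NE7b.GaussianShiftedFibre
open Summit.QuantumFields.BalabanUV.T4Continuum.NE7b.GaussianDeterminant
open Summit.QuantumFields.BalabanUV.T4Continuum.NE7b.AndersonGaussianComparison
open Summit.QuantumFields.BalabanUV.T4Continuum.NE7b.LogConcaveDominatedMoment

namespace Summit.QuantumFields.BalabanUV.T4Continuum.NE7b.LogConcaveShiftedFibre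

variable {n : Type*} [Fintype n] [DecidableEq n]

/-! ## §1 Anderson's shift inequality in Bochner form for a positive-definite Gaussian weight -/

/-- **ANDERSON's SHIFT INEQUALITY, BOCHNER FORM.**  For `A` positive definite and `F ≥ 0` measurable, even, midpoint-log-concave, every
translate of `F` weighs at most as much as `F` against the centred Gaussian `e^{−uᵀAu}`:
`∫ F(u − m)·e^{−uᵀAu} du ≤ ∫ F(u)·e^{−uᵀAu} du`.  (`AndersonGaussianComparison.lintegral_shift_mul_le` + `F ≤ F 0`.) [folklore] -/
theorem integral_shift_mul_exp_neg_qf_le {A : Matrix n n ℝ} (hA : A.PosDef) {F : (n → ℝ) → ℝ} (hF0 : ∀ x, 0 ≤ F x)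
    (hFm : Measurable F) (hFe : ∀ x, F (-x) = F x) (hFlc : ∀ x y, F x * F y ≤ F ((2 : ℝ)⁻¹ • (x + y)) ^ 2) (m : n → ℝ) :
    ∫ u, F (u - m) * exp (-(u ⬝ᵥ (A *ᵥ u))) ≤ ∫ u, F u * exp (-(u ⬝ᵥ (A *ᵥ u))) := by
  have hρm : Measurable fun u : n → ℝ => exp (-(u ⬝ᵥ (A *ᵥ u))) := (continuous_qf A).neg.rexp.measurable
  have hFb : ∀ x, ‖F x‖ ≤ F 0 := fun x => by
    rw [Real.norm_eq_abs, abs_of_nonneg (hF0 _)]; exact le_zero_of_evenLogConcave hF0 hFe hFlc _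
  -- both sides as `ℝ≥0∞` integrals
  have hintR : Integrable (fun u : n → ℝ => F u * exp (-(u ⬝ᵥ (A *ᵥ u)))) :=
    (integrable_exp_neg_qf hA).bdd_mul hFm.aestronglyMeasurable (Filter.Eventually.of_forall hFb)
  have hintL : Integrable (fun u : n → ℝ => F (u - m) * exp (-(u ⬝ᵥ (A *ᵥ u)))) :=
    (integrable_exp_neg_qf hA).bdd_mul (hFm.comp (measurable_id.sub_const m)).aestronglyMeasurable
      (Filter.Eventually.of_forall fun u => hFb _)
  rw [integral_eq_lintegral_of_nonneg_ae (Filter.Eventually.of_forall fun u => mul_nonneg (hF0 _) (exp_pos _).le)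
      hintL.aestronglyMeasurable,
    integral_eq_lintegral_of_nonneg_ae (Filter.Eventually.of_forall fun u => mul_nonneg (hF0 _) (exp_pos _).le)
      hintR.aestronglyMeasurable]
  refine ENNReal.toReal_mono ((lintegral_ofReal_ne_top_iff_integrable hintR.aestronglyMeasurable
    (Filter.Eventually.of_forall fun u => mul_nonneg (hF0 _) (exp_pos _).le)).2 hintR) ?_
  -- the `ℝ≥0∞` form is the companion's functional Anderson with `G = ofReal ∘ F`, `ρ = ofReal ∘ e^{−uᵀAu}`, `w = −m`
  have hGm : Measurable fun u => ENNReal.ofReal (F u) := hFm.ennreal_ofReal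
  have hGe : ∀ u, ENNReal.ofReal (F (-u)) = ENNReal.ofReal (F u) := fun u => by rw [hFe]
  have hGlc : ∀ x y, ENNReal.ofReal (F x) * ENNReal.ofReal (F y) ≤ ENNReal.ofReal (F ((2 : ℝ)⁻¹ • (x + y))) ^ 2 :=
    fun x y => by
      rw [← ENNReal.ofReal_mul (hF0 _), ← ENNReal.ofReal_pow (hF0 _)]
      exact ENNReal.ofReal_le_ofReal (hFlc x y)
  have hRe : ∀ u : n → ℝ, ENNReal.ofReal (exp (-((-u) ⬝ᵥ (A *ᵥ (-u))))) = ENNReal.ofReal (exp (-(u ⬝ᵥ (A *ᵥ u)))) :=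
    fun u => by rw [mulVec_neg, dotProduct_neg, neg_dotProduct, neg_neg]
  have hRlc : ∀ x y : n → ℝ, ENNReal.ofReal (exp (-(x ⬝ᵥ (A *ᵥ x)))) * ENNReal.ofReal (exp (-(y ⬝ᵥ (A *ᵥ y)))) ≤
      ENNReal.ofReal (exp (-(((2 : ℝ)⁻¹ • (x + y)) ⬝ᵥ (A *ᵥ ((2 : ℝ)⁻¹ • (x + y)))))) ^ 2 := fun x y => by
    rw [← ENNReal.ofReal_mul (exp_pos _).le, ← ENNReal.ofReal_pow (exp_pos _).le, ← exp_add, ← exp_nat_mul]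
    refine ENNReal.ofReal_le_ofReal (exp_le_exp.2 ?_)
    have h := qf_midpoint_le hA.posSemidef x y
    push_cast
    linarith
  have key := lintegral_shift_mul_le hGm hρm.ennreal_ofReal hGe hRe hGlc hRlc (-m)
  refine le_of_eq_of_le (lintegral_congr fun u => ?_) (key.trans (le_of_eq (lintegral_congr fun u => ?_)))
  · rw [ENNReal.ofReal_mul (hF0 _), sub_eq_add_neg]
  · rw [ENNReal.ofReal_mul (hF0 _)]

/-! ## §2 The shifted numerator at the sharp Gaussian exponent -/

/-- **THE SHIFTED NUMERATOR FOR AN EVEN LOG-CONCAVE WINDOW — SHARP EXPONENT, NO YOUNG INFLATION.**  `S` positive definite, `Q` positive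
semidefinite, `Q ≤ δS` (`0 ≤ δ < 1`), `rank Q ≤ r`; `F ≥ 0` measurable, even, midpoint-log-concave; `v` any linear shift.  Then, with
`m₁ = (S−Q)⁻¹v`,  `∫ F·e^{xᵀQx}·e^{−(xᵀSx + 2x·v)} ≤ e^{m₁ᵀ(S−Q)m₁} · (√(1−δ))⁻¹ ^ r · ∫ F·e^{−xᵀSx}` — complete the square in the
WIDE form `S − Q` (OWNER `shifted_integral_eq_translated`), drop the translate by §1, then `LogConcaveDominatedMoment.logConcaveMoment_le`.
At `F ≡ 1` the `v`-dependence `e^{vᵀ(S−Q)⁻¹v}` is exact. [folklore] -/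
theorem logConcaveShiftedNumerator_le {S Q : Matrix n n ℝ} {δ : ℝ} {r : ℕ} (hS : S.PosDef) (hQ : Q.PosSemidef)
    (hdom : (δ • S - Q).PosSemidef) (hδ0 : 0 ≤ δ) (hδ : δ < 1) (hr : Q.rank ≤ r) (v : n → ℝ) {F : (n → ℝ) → ℝ}
    (hF0 : ∀ x, 0 ≤ F x) (hFm : Measurable F) (hFe : ∀ x, F (-x) = F x)
    (hFlc : ∀ x y, F x * F y ≤ F ((2 : ℝ)⁻¹ • (x + y)) ^ 2) :
    ∫ x, F x * (exp (x ⬝ᵥ (Q *ᵥ x)) * exp (-(x ⬝ᵥ (S *ᵥ x) + 2 * (x ⬝ᵥ v)))) ≤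
      exp (((S - Q)⁻¹ *ᵥ v) ⬝ᵥ ((S - Q) *ᵥ ((S - Q)⁻¹ *ᵥ v))) * (√(1 - δ))⁻¹ ^ r *
        ∫ x, F x * exp (-(x ⬝ᵥ (S *ᵥ x))) := by
  have hSQ : (S - Q).PosDef := posDef_sub_of_dominated hS hdom hδ
  have hsymm : (S - Q).IsSymm := by
    have h := hSQ.1
    rw [IsHermitian, conjTranspose_eq_transpose_of_trivial] at h
    exact h
  have hdet : IsUnit (S - Q).det := isUnit_iff_ne_zero.2 hSQ.det_pos.ne'
  set m₁ : n → ℝ := (S - Q)⁻¹ *ᵥ v with hm₁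
  -- the integrand in the wide form `S − Q`
  have e0 : ∀ x : n → ℝ, F x * (exp (x ⬝ᵥ (Q *ᵥ x)) * exp (-(x ⬝ᵥ (S *ᵥ x) + 2 * (x ⬝ᵥ v)))) =
      F x * exp (-(x ⬝ᵥ ((S - Q) *ᵥ x) + 2 * (x ⬝ᵥ v))) := fun x => by
    rw [← exp_add, qf_sub]; ring_nf
  simp_rw [e0]
  -- complete the square and drop the translate
  rw [shifted_integral_eq_translated hsymm hdet v F]
  have h1 : ∫ u, F (u - m₁) * exp (-(u ⬝ᵥ ((S - Q) *ᵥ u))) ≤ ∫ u, F u * exp (-(u ⬝ᵥ ((S - Q) *ᵥ u))) :=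
    integral_shift_mul_exp_neg_qf_le hSQ hF0 hFm hFe hFlc m₁
  -- back to the pair `(S, Q)` and the domination lemma
  have e1 : ∫ u, F u * exp (-(u ⬝ᵥ ((S - Q) *ᵥ u))) = ∫ u, F u * (exp (u ⬝ᵥ (Q *ᵥ u)) * exp (-(u ⬝ᵥ (S *ᵥ u)))) :=
    integral_congr_ae (Filter.Eventually.of_forall fun u => by simp only [qf_sub, ← exp_add]; ring_nf)
  have h2 := logConcaveMoment_le hS hQ hdom hδ0 hδ hr hF0 hFm hFe hFlc
  have hE : 0 ≤ exp (m₁ ⬝ᵥ ((S - Q) *ᵥ m₁)) := (exp_pos _).le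
  calc exp (m₁ ⬝ᵥ ((S - Q) *ᵥ m₁)) * ∫ u, F (u - m₁) * exp (-(u ⬝ᵥ ((S - Q) *ᵥ u)))
      ≤ exp (m₁ ⬝ᵥ ((S - Q) *ᵥ m₁)) * ((√(1 - δ))⁻¹ ^ r * ∫ x, F x * exp (-(x ⬝ᵥ (S *ᵥ x)))) :=
        mul_le_mul_of_nonneg_left (h1.trans (e1.le.trans h2)) hE
    _ = exp (m₁ ⬝ᵥ ((S - Q) *ᵥ m₁)) * (√(1 - δ))⁻¹ ^ r * ∫ x, F x * exp (-(x ⬝ᵥ (S *ᵥ x))) := by ring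

/-! ## §3 The ratio under the displayed displacement letter -/

/-- **THE SHIFTED FIBRE MOMENT OF AN EVEN LOG-CONCAVE WINDOW.**  In the situation of `logConcaveShiftedNumerator_le`, suppose the window
displaced by the induced mean `m₀ = S⁻¹v` keeps the fraction `1 − η'` (`η' < 1`) of its own Gaussian mass — the (R1″) letter in relative
form, `hdisp : (1−η')·∫ F e^{−xᵀSx} ≤ ∫ F(u − m₀) e^{−uᵀSu}`.  Then the shifted moment ratio obeys
`∫ F e^{Q} e^{−(S + 2v)} ≤ (e^{E} · (√(1−δ))⁻¹ ^ r ∕ (1−η')) · ∫ F e^{−(S + 2v)}` with the SHARP exponent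
`E = m₁ᵀ(S−Q)m₁ − m₀ᵀSm₀ = vᵀ((S−Q)⁻¹ − S⁻¹)v` (no Young `ε`, no inflated `δ'`). [folklore] -/
theorem logConcaveShiftedMoment_le {S Q : Matrix n n ℝ} {δ η' : ℝ} {r : ℕ} (hS : S.PosDef) (hQ : Q.PosSemidef)
    (hdom : (δ • S - Q).PosSemidef) (hδ0 : 0 ≤ δ) (hδ : δ < 1) (hr : Q.rank ≤ r) (v : n → ℝ) {F : (n → ℝ) → ℝ}
    (hF0 : ∀ x, 0 ≤ F x) (hFm : Measurable F) (hFe : ∀ x, F (-x) = F x)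
    (hFlc : ∀ x y, F x * F y ≤ F ((2 : ℝ)⁻¹ • (x + y)) ^ 2) (hη : η' < 1)
    (hdisp : (1 - η') * ∫ x, F x * exp (-(x ⬝ᵥ (S *ᵥ x))) ≤ ∫ u, F (u - S⁻¹ *ᵥ v) * exp (-(u ⬝ᵥ (S *ᵥ u)))) :
    ∫ x, F x * (exp (x ⬝ᵥ (Q *ᵥ x)) * exp (-(x ⬝ᵥ (S *ᵥ x) + 2 * (x ⬝ᵥ v)))) ≤
      (exp (((S - Q)⁻¹ *ᵥ v) ⬝ᵥ ((S - Q) *ᵥ ((S - Q)⁻¹ *ᵥ v)) - (S⁻¹ *ᵥ v) ⬝ᵥ (S *ᵥ (S⁻¹ *ᵥ v))) *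
          (√(1 - δ))⁻¹ ^ r / (1 - η')) *
        ∫ x, F x * exp (-(x ⬝ᵥ (S *ᵥ x) + 2 * (x ⬝ᵥ v))) := by
  have hsymm : S.IsSymm := by
    have h := hS.1
    rw [IsHermitian, conjTranspose_eq_transpose_of_trivial] at h
    exact h
  have hdet : IsUnit S.det := isUnit_iff_ne_zero.2 hS.det_pos.ne'
  set m₀ : n → ℝ := S⁻¹ *ᵥ v with hm₀
  set m₁ : n → ℝ := (S - Q)⁻¹ *ᵥ v with hm₁
  set IF : ℝ := ∫ x, F x * exp (-(x ⬝ᵥ (S *ᵥ x))) with hIF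
  set κ : ℝ := (√(1 - δ))⁻¹ ^ r with hκ
  have h1η : 0 < 1 - η' := by linarith
  have hκ0 : 0 ≤ κ := pow_nonneg (inv_nonneg.2 (Real.sqrt_nonneg _)) r
  have hIF0 : 0 ≤ IF := integral_nonneg fun x => mul_nonneg (hF0 x) (exp_pos _).le
  -- numerator (§2) and denominator (complete the square in `S`, then `hdisp`)
  have hN := logConcaveShiftedNumerator_le hS hQ hdom hδ0 hδ hr v hF0 hFm hFe hFlc
  have eD : ∫ x, F x * exp (-(x ⬝ᵥ (S *ᵥ x) + 2 * (x ⬝ᵥ v))) = exp (m₀ ⬝ᵥ (S *ᵥ m₀)) * ∫ u, F (u - m₀) * exp (-(u ⬝ᵥ (S *ᵥ u))) :=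
    shifted_integral_eq_translated hsymm hdet v F
  have hD : exp (m₀ ⬝ᵥ (S *ᵥ m₀)) * ((1 - η') * IF) ≤ ∫ x, F x * exp (-(x ⬝ᵥ (S *ᵥ x) + 2 * (x ⬝ᵥ v))) := by
    rw [eD]; exact mul_le_mul_of_nonneg_left hdisp (exp_pos _).le
  -- `IF ≤ e^{−m₀ᵀSm₀}·D∕(1−η')`
  have hIF_le : IF ≤ exp (-(m₀ ⬝ᵥ (S *ᵥ m₀))) / (1 - η') * ∫ x, F x * exp (-(x ⬝ᵥ (S *ᵥ x) + 2 * (x ⬝ᵥ v))) := by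
    rw [div_mul_eq_mul_div, le_div_iff₀ h1η, exp_neg]
    have h := mul_le_mul_of_nonneg_left hD (inv_nonneg.2 (exp_pos (m₀ ⬝ᵥ (S *ᵥ m₀))).le)
    rw [← mul_assoc, inv_mul_cancel₀ (exp_pos _).ne', one_mul] at h
    linarith
  calc ∫ x, F x * (exp (x ⬝ᵥ (Q *ᵥ x)) * exp (-(x ⬝ᵥ (S *ᵥ x) + 2 * (x ⬝ᵥ v))))
      ≤ exp (m₁ ⬝ᵥ ((S - Q) *ᵥ m₁)) * κ * IF := hN
    _ ≤ exp (m₁ ⬝ᵥ ((S - Q) *ᵥ m₁)) * κ *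
          (exp (-(m₀ ⬝ᵥ (S *ᵥ m₀))) / (1 - η') * ∫ x, F x * exp (-(x ⬝ᵥ (S *ᵥ x) + 2 * (x ⬝ᵥ v)))) :=
        mul_le_mul_of_nonneg_left hIF_le (mul_nonneg (exp_pos _).le hκ0)
    _ = (exp (m₁ ⬝ᵥ ((S - Q) *ᵥ m₁) - m₀ ⬝ᵥ (S *ᵥ m₀)) * κ / (1 - η')) *
          ∫ x, F x * exp (-(x ⬝ᵥ (S *ᵥ x) + 2 * (x ⬝ᵥ v))) := by
        rw [exp_sub, div_eq_mul_inv (exp _) (exp _), ← exp_neg]; ring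

/-! ## §4 The sharp exponent against the OWNER's induced-mean letter `m₀ᵀQm₀` -/

omit [DecidableEq n] in
/-- For an invertible symmetric-or-not `M` with `IsUnit M.det`: `(M⁻¹v)ᵀM(M⁻¹v) = vᵀM⁻¹v`. [folklore] -/
theorem qf_inv_mulVec [DecidableEq n] {M : Matrix n n ℝ} (hM : IsUnit M.det) (v : n → ℝ) :
    (M⁻¹ *ᵥ v) ⬝ᵥ (M *ᵥ (M⁻¹ *ᵥ v)) = (M⁻¹ *ᵥ v) ⬝ᵥ v := by
  rw [mulVec_mulVec, mul_nonsing_inv _ hM, one_mulVec]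

/-- **THE SHARP EXPONENT AGAINST THE INDUCED-MEAN ENERGY** (refuter κ-ne7bref-g66-1's inequality `mᵀQm ≤ E ≤ mᵀQm∕(1−δ)` as a
theorem): for `S` positive definite, `Q` positive semidefinite, `Q ≤ δS`, `δ < 1`, and any `v`, with `m₀ = S⁻¹v`,
`m₀ᵀQm₀ ≤ E(v) ≤ (1−δ)⁻¹·m₀ᵀQm₀` where `E(v) = ((S−Q)⁻¹v)ᵀ(S−Q)((S−Q)⁻¹v) − (S⁻¹v)ᵀS(S⁻¹v)`.  (Simultaneous diagonalisation
`AᵀSA = 1`, `AᵀQA = diag d`, `0 ≤ dᵢ ≤ δ`: `S⁻¹ = AAᵀ`, `(S−Q)⁻¹ = A·diag((1−dᵢ)⁻¹)·Aᵀ`, `E = Σ dᵢ(1−dᵢ)⁻¹wᵢ²`, `m₀ᵀQm₀ = Σ dᵢwᵢ²`,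
`w = Aᵀv`.)  So the (R1″) suppliers of `m₀ᵀQm₀ ≤ B₀` (OWNER `GaussianShiftedFibre` ∕ gaps-ne6 `GaussianInducedMeanDecay`) feed §3 at
`e^{B₀∕(1−δ)}`. [folklore] -/
theorem shiftExponent_bounds {S Q : Matrix n n ℝ} {δ : ℝ} (hS : S.PosDef) (hQ : Q.PosSemidef) (hdom : (δ • S - Q).PosSemidef)
    (hδ : δ < 1) (v : n → ℝ) :
    (S⁻¹ *ᵥ v) ⬝ᵥ (Q *ᵥ (S⁻¹ *ᵥ v)) ≤
        ((S - Q)⁻¹ *ᵥ v) ⬝ᵥ ((S - Q) *ᵥ ((S - Q)⁻¹ *ᵥ v)) - (S⁻¹ *ᵥ v) ⬝ᵥ (S *ᵥ (S⁻¹ *ᵥ v)) ∧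
      ((S - Q)⁻¹ *ᵥ v) ⬝ᵥ ((S - Q) *ᵥ ((S - Q)⁻¹ *ᵥ v)) - (S⁻¹ *ᵥ v) ⬝ᵥ (S *ᵥ (S⁻¹ *ᵥ v)) ≤
        (1 - δ)⁻¹ * ((S⁻¹ *ᵥ v) ⬝ᵥ (Q *ᵥ (S⁻¹ *ᵥ v))) := by
  obtain ⟨A, d, hA, hSA, hQA⟩ := exists_transpose_mul_self_eq_one_and_diagonal hS hQ
  have hSQ : (S - Q).PosDef := posDef_sub_of_dominated hS hdom hδ
  have hdetS : IsUnit S.det := isUnit_iff_ne_zero.2 hS.det_pos.ne'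
  have hdetSQ : IsUnit (S - Q).det := isUnit_iff_ne_zero.2 hSQ.det_pos.ne'
  -- the diagonal entries: `0 ≤ dᵢ ≤ δ < 1`
  have hd0 : ∀ i, 0 ≤ d i := fun i => by
    have h := diag_nonneg_of_posSemidef (posSemidef_transpose_mul_mul hQ A) i
    rwa [hQA, diagonal_apply_eq] at h
  have hdδ : ∀ i, d i ≤ δ := fun i => by
    have h := diag_nonneg_of_posSemidef (posSemidef_transpose_mul_mul hdom A) i
    have e : Aᵀ * (δ • S - Q) * A = δ • (1 : Matrix n n ℝ) - diagonal d := by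
      rw [Matrix.mul_sub, Matrix.sub_mul, Matrix.mul_smul, Matrix.smul_mul, hSA, hQA]
    rw [e, Matrix.sub_apply, Matrix.smul_apply, one_apply_eq, diagonal_apply_eq, smul_eq_mul, mul_one] at h
    linarith
  have h1d : ∀ i, 0 < 1 - d i := fun i => by linarith [hdδ i]
  -- `S⁻¹ = A Aᵀ`
  have hSinv : S⁻¹ = A * Aᵀ := by
    refine inv_eq_right_inv ?_
    have h : Aᵀ * (S * A) = 1 := by rw [← Matrix.mul_assoc, hSA]
    rw [← Matrix.mul_assoc]
    exact mul_eq_one_comm.1 h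
  -- `(S − Q)⁻¹ = A D' Aᵀ` with `D' = diag((1 − dᵢ)⁻¹)`
  set D' : Matrix n n ℝ := diagonal fun i => (1 - d i)⁻¹ with hD'
  have hASQA : Aᵀ * (S - Q) * A = diagonal fun i => 1 - d i := by
    rw [Matrix.mul_sub, Matrix.sub_mul, hSA, hQA, ← diagonal_one, diagonal_sub]
  have hSQinv : (S - Q)⁻¹ = A * D' * Aᵀ := by
    refine inv_eq_right_inv ?_
    have h : Aᵀ * ((S - Q) * (A * D')) = 1 := by
      rw [← Matrix.mul_assoc, ← Matrix.mul_assoc, hASQA, hD', diagonal_mul_diagonal, ← diagonal_one]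
      exact congrArg diagonal (funext fun i => mul_inv_cancel₀ (h1d i).ne')
    have h' := mul_eq_one_comm.1 h
    rwa [Matrix.mul_assoc, Matrix.mul_assoc, ← Matrix.mul_assoc A] at h'
  -- the three forms in the coordinates `w = Aᵀ v`
  set w : n → ℝ := Aᵀ *ᵥ v with hw
  have e1 : (S⁻¹ *ᵥ v) ⬝ᵥ (S *ᵥ (S⁻¹ *ᵥ v)) = ∑ i, w i ^ 2 := by
    rw [qf_inv_mulVec hdetS, hSinv, ← mulVec_mulVec, dotProduct_comm, dotProduct_mulVec, ← mulVec_transpose, ← hw]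
    simp only [dotProduct, pow_two]
  have e2 : ((S - Q)⁻¹ *ᵥ v) ⬝ᵥ ((S - Q) *ᵥ ((S - Q)⁻¹ *ᵥ v)) = ∑ i, (1 - d i)⁻¹ * w i ^ 2 := by
    rw [qf_inv_mulVec hdetSQ, hSQinv, ← mulVec_mulVec, ← mulVec_mulVec, dotProduct_comm, dotProduct_mulVec, ← mulVec_transpose,
      ← hw, hD', qf_diagonal]
  have e3 : (S⁻¹ *ᵥ v) ⬝ᵥ (Q *ᵥ (S⁻¹ *ᵥ v)) = ∑ i, d i * w i ^ 2 := by
    rw [hSinv, ← mulVec_mulVec, ← hw, qf_mulVec, hQA, qf_diagonal]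
  rw [e1, e2, e3, ← Finset.sum_sub_distrib, Finset.mul_sum]
  constructor
  · refine Finset.sum_le_sum fun i _ => ?_
    have hw2 : 0 ≤ w i ^ 2 := sq_nonneg _
    -- `dᵢ + 1 ≤ (1−dᵢ)⁻¹` since `(1+dᵢ)(1−dᵢ) = 1 − dᵢ² ≤ 1`
    have key : d i + 1 ≤ (1 - d i)⁻¹ := by
      rw [inv_eq_one_div, le_div_iff₀ (h1d i)]
      nlinarith [hd0 i]
    nlinarith
  · refine Finset.sum_le_sum fun i _ => ?_
    have hw2 : 0 ≤ w i ^ 2 := sq_nonneg _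
    have h1δ : 0 < 1 - δ := by linarith
    -- `(1−dᵢ)⁻¹ − 1 = (1−dᵢ)⁻¹·dᵢ ≤ (1−δ)⁻¹·dᵢ`
    have e : (1 - d i)⁻¹ - 1 = (1 - d i)⁻¹ * d i := by
      have h := (h1d i).ne'
      field_simp
      ring
    have key : (1 - d i)⁻¹ - 1 ≤ (1 - δ)⁻¹ * d i := by
      rw [e]
      exact mul_le_mul_of_nonneg_right (inv_anti₀ h1δ (by linarith [hdδ i])) (hd0 i)
    nlinarith

/-- **IN THE OWNER's LETTERS**: with an induced-mean energy bound `m₀ᵀQm₀ ≤ B₀` (`m₀ = S⁻¹v`; the (R1″) supply of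
`GaussianShiftedFibre.shiftedMoment_le_of_inducedMean_le` ∕ gaps-ne6's `inducedMeanEnergy_le_of_decay`) and the displacement letter
`hdisp`, the shifted moment ratio of an even log-concave window is `≤ e^{B₀∕(1−δ)}·(√(1−δ))⁻¹ ^ r ∕ (1−η')` — no Young `ε`, no `δ'`.
[folklore] -/
theorem logConcaveShiftedMoment_le_of_inducedMean_le {S Q : Matrix n n ℝ} {δ η' B₀ : ℝ} {r : ℕ} (hS : S.PosDef)
    (hQ : Q.PosSemidef) (hdom : (δ • S - Q).PosSemidef) (hδ0 : 0 ≤ δ) (hδ : δ < 1) (hr : Q.rank ≤ r) (v : n → ℝ)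
    {F : (n → ℝ) → ℝ} (hF0 : ∀ x, 0 ≤ F x) (hFm : Measurable F) (hFe : ∀ x, F (-x) = F x)
    (hFlc : ∀ x y, F x * F y ≤ F ((2 : ℝ)⁻¹ • (x + y)) ^ 2) (hη : η' < 1)
    (hdisp : (1 - η') * ∫ x, F x * exp (-(x ⬝ᵥ (S *ᵥ x))) ≤ ∫ u, F (u - S⁻¹ *ᵥ v) * exp (-(u ⬝ᵥ (S *ᵥ u))))
    (hB : (S⁻¹ *ᵥ v) ⬝ᵥ (Q *ᵥ (S⁻¹ *ᵥ v)) ≤ B₀) :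
    ∫ x, F x * (exp (x ⬝ᵥ (Q *ᵥ x)) * exp (-(x ⬝ᵥ (S *ᵥ x) + 2 * (x ⬝ᵥ v)))) ≤
      (exp (B₀ / (1 - δ)) * (√(1 - δ))⁻¹ ^ r / (1 - η')) * ∫ x, F x * exp (-(x ⬝ᵥ (S *ᵥ x) + 2 * (x ⬝ᵥ v))) := by
  have h := logConcaveShiftedMoment_le hS hQ hdom hδ0 hδ hr v hF0 hFm hFe hFlc hη hdisp
  have hE := (shiftExponent_bounds hS hQ hdom hδ v).2
  have h1δ : 0 < 1 - δ := by linarith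
  have hE' : ((S - Q)⁻¹ *ᵥ v) ⬝ᵥ ((S - Q) *ᵥ ((S - Q)⁻¹ *ᵥ v)) - (S⁻¹ *ᵥ v) ⬝ᵥ (S *ᵥ (S⁻¹ *ᵥ v)) ≤ B₀ / (1 - δ) := by
    rw [div_eq_inv_mul]
    exact hE.trans (mul_le_mul_of_nonneg_left hB (inv_nonneg.2 h1δ.le))
  have hD : 0 ≤ ∫ x, F x * exp (-(x ⬝ᵥ (S *ᵥ x) + 2 * (x ⬝ᵥ v))) :=
    integral_nonneg fun x => mul_nonneg (hF0 x) (exp_pos _).le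
  refine h.trans (mul_le_mul_of_nonneg_right ?_ hD)
  refine div_le_div_of_nonneg_right (mul_le_mul_of_nonneg_right (exp_le_exp.2 hE') ?_) (by linarith)
  exact pow_nonneg (inv_nonneg.2 (Real.sqrt_nonneg _)) r

end Summit.QuantumFields.BalabanUV.T4Continuum.NE7b.LogConcaveShiftedFibre
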